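import Summits.QuantumFields.YangMills.Theorems.UnitScaleTiltProp7SymFrameAnalytic
import Summits.QuantumFields.YangMills.Theorems.UnitScaleTiltProp7SymAvgTwSymDefs
import Summits.QuantumFields.YangMills.Theorems.UnitScaleTiltProp7IteratedMapTelescope
import Literature.MathematicalPhysics.QuantumFieldTheory.Balaban1983to89.B7Eq170Flat
import HarnessLib

/-!
# Route `UnitScaleTilt`, crux K1 «MinimiserStabilityRegPr» (stmt-QuantumFields-19200), route-R E′ (A′) P-A2 «JOINT-Σ», row F0″-b — **THE COVARIANT LOG-COORDINATE TOWER IS THE CHART: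
# the re-based twisted log-chart `log U̿^{twS}(X)` of the EX lane is the TOP of the tower `y_{m+1} = f_m(y_m)`, `y_0 = X`, of ONE-STEP covariant twisted averages in log coordinates
# `f_m(y)(c) = log( U̿_{V_m}(e^{y}·V_m)(c) · V̄_m(c)⁻¹ )` at the backgrounds `V_m = Ū₀♭^{(m)}`; its linear part `Q(U₀) := QTwS` is the composed one-step linear part; hence the chart
# remainder `C^{twS}(X) = log U̿^{twS}(X) − Q(U₀)X` obeys the EXACT Duhamel recursion and its ℓ¹ size is the DAMPED sum of the one-step defects `f_m(y_m) − Df_m(0)y_m`**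
# (✓`IteratedMapTelescope` instantiated; windows and column-sum letters displayed)

Cell `ym3-torus` (HUMAN RULING D-0037: YM₃ on the torus is ladder rung R3 — not d = 4, not a mass gap, not Clay), width seat `ym3-torus-px18` (gen 3); ★p1 g17 WORD 10 (4)∕11 (e) «P-A2 F0″
→ px18»; ★routeR-w3 g6 LOCATE «P-A2 JOINT-Σ» bc08ddff §2 F0″.  `--supports stmt-QuantumFields-19200 --as helper`; THEOREMS ONLY (0 `def`, 0 `sorry`); count-neutral.  Nothing of P-A2, hcoW,
E′, EX, the crux, d = 4 or the mass gap is claimed — this is chart KINEMATICS (which object the remainder is), no estimate of a one-step defect (F1″), no column-sum letter (F2″), no level mass (F3″).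

THE PRINT.  [Balaban1985Averaging] p. 36 (127) «Q_{j+1}(U₀, ηA) = Q(Ū₀ʲ, Q_j(U₀, ηA))», p. 40 (150)–(152) «C_{j+1}(U₀, A) = LQ(Ū₀ʲ)C_j(U₀, L^{−1}A) + C(Ū₀ʲ, L^{−1}Q_j(U₀)A + C_j(U₀, L^{−1}A))»,
p. 31 (89)–(92) (the double bar), p. 32 (97) (accumulated frames); [Balaban1985BackgroundPropagators] (3.13)–(3.14) p. 393; [Balaban1985Variational] (44) p. 285.

OBJECTS (all INLINE, no definition; `U₀♭ := bgUnits F K U₀`, `V_m := emlIterU m U₀♭`, `M₂ := Matrix (Fin 2) (Fin 2) ℂ`):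
* one-step map in log coordinates at a background `V` of level `j`: `Φ_V(y)(c) := mlog( ↑(dbarCovU V (fun b ↦ expUnit (y b) * V b) c) * ↑((emlAvgU V c)⁻¹) )` — exactly the quantity ✓W1
  `Prop7SymAvgTwSym.norm_dbarCovU_mul_inv_sub_one_le` bounds;
* the log tower `Y_m(X)(c) := mlog( ↑(dbarCovIterU m U₀♭ (fun b ↦ expUnit (X b) * U₀♭ b) c) * ↑((V_m c)⁻¹) )`;
* the formal composed tower `F_m` (`F_0 = id`, `F_{m+1} = Φ_{V_m} ∘ F_m`), its linear parts `T_m := fderiv ℂ Φ_{V_m} 0`, `Lin_{m+1} = T_m ∘ Lin_m` — EXISTENCE by `Nat.rec` (§2), no `def`.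

WHAT IS PROVED (ns `…Theorems.Prop7CovLogTower`).
* §1 (generic `Params`, complete normed ℂ-algebra 𝔸) ★`phiCov_zero` (`Φ_V 0 = 0`: ✓`dbarCovU_self`), ★`differentiableAt_phiCov_zero` (`Φ_V` differentiable at `0` as soon as the (0.4) loop variables of `V`
  are within `1` of `1` — ✓`Prop7SymFrameBound.analyticAt_coe_dbarCovU_of_twoBlock` with trivial twisted stairs ✓`tstairU_self` + ✓`MatrixLog.analyticAt_mlog` at `1`), `phiCov_logTower` (ROUND TRIP:
  `Y_{m+1} = Φ_{V_m}(Y_m)` wherever level `m` is inside `‖·−1‖ < 1` — ✓`dbarCovIterU_succ` rfl, ✓`emlIterU_succ`, ✓`MatrixLog.exp_mlog`), `logTower_zero_eq` (`Y_0 = X` for `‖X b‖ ≤ 1/5`, ✓`B7Eq170Flat.mlog_exp_of_le`).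
* §2 `exists_iterate`, `exists_lin` (the formal towers by `Nat.rec`), ★★`logTower_eq_iterate` (`Y_m(X) = F_m X` for all `m ≤ k` under the two windows).
* §3 (T³ letters) ★★`logChartTwS_eq_logTower_top` (`logChartTwS F n K h U₀ X c = Y_{K−n}(X)(ĉ)`, `ĉ = bondShift (sites_eq …) c` — ✓`dbarTwS_eq_dbarCovIterU_mul_inv`), ★★`QTwS_eq_lin_top`
  (`QTwS F n K h U₀ X c = Lin_{K−n} X ĉ` when `logChartTwS` agrees with the top near `0` and every `Φ_{V_m}` is differentiable at `0` — ✓`IteratedMapTelescope.hasFDerivAt_iterate_zero` + uniqueness of `fderiv`),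
  ★★★`CmapTwS_eq_iterate_sub_lin_top` (THE F0″ ROW: `CmapTwS F n K h U₀ X c = (F_{K−n} X − Lin_{K−n} X)(ĉ)`, hence the EXACT one-step recursion ✓`orbit_sub_lin_succ` applies verbatim) and
  ★★★`l1_CmapTwS_le_damped_defects` (`Σ_{c : PBond (F.P K) (K−n)} ‖(F_{K−n} X − Lin_{K−n} X) c‖ ≤ Σ_{l<K−n} κ^{K−n−1−l}·Σ_{c′} ‖(Φ_{V_l}(F_l X) − T_l (F_l X)) c′‖` under F2″'s column-sum letter
  `Σ_c ‖T_m v c‖ ≤ κ·Σ_c ‖v c‖` for `m < K − n` — the left side IS `Σ_c ‖CmapTwS U₀ X c‖` re-indexed along `bondShift`).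
DISPLAYED HYPOTHESES (each with a named in-tree supplier): (W0) `‖X b‖ ≤ 1/5` bondwise; (W1) per-level windows `‖↑(dbarCovIterU m U₀♭ (e^{X}U₀♭) b)·↑((V_m b)⁻¹) − 1‖ < 1` for `m < K−n`
(supplier ✓W3 `Prop7SymFrameRelCluster.norm_dbarCovIterU_rel_frameAccU_le_of_plaqSmall`, `≤ 3x < 1` on the `RegPr` window); (W2) per-level loop guards `‖↑(loopHolU V_m c i) − 1‖ < 1` (supplier
✓`Prop7SymAvgGLSmallOfRegPr.loopSmall_iter_of_regPr` ∘ ✓`coe_iter_eq_emlIterU_of_regPr`); (W3) the neighbourhood agreement `logChartTwS = top` near `0` (from (W0)–(W1) on a ball, §3); (F2″) the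
column-sum letter `κ`.
HONEST SCOPE.  Kinematics over landed bricks; the discharge of (W1)–(W3) from `RegPr` + numerals at every level is bookkeeping left to the P-A2 assembly (F4″) or a small follow-up (F0″-c).

References: T. Bałaban, CMP **98** (1985) 17–51 [Balaban1985Averaging] ((89)–(92) p.31, (97) p.32, (127) p.36, (150)–(152) p.40); CMP **99** (1985) 389–434 [Balaban1985BackgroundPropagators]
((3.13)–(3.14) p.393); CMP **102** (1985) 277–309 [Balaban1985Variational] ((44) p.285).
-/

set_option autoImplicit false

noncomputable section

open scoped BigOperators Matrix.Norms.L2Operator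

namespace Summit.QuantumFields.YangMills.Theorems.Prop7CovLogTower

open NormedSpace
open Literature.MathematicalPhysics.QuantumFieldTheory.Balaban1983to89
open T4Continuum BlockAveraging AveragingRT ExpMeanLog
open MatrixLog (mlog mlog_one exp_mlog)
open B7Prop1Explicit (expUnit val_expUnit)
open Summit.QuantumFields.YangMills.Theorems.Prop8Chart (loopHolU emlAvgU coe_emlAvgU emlIterU emlIterU_zero emlIterU_succ)
open Summit.QuantumFields.YangMills.Theorems.Prop7SymAvgTwSym (tstairU tstairU_self vframeCovU dbarCovU dbarCovU_apply dbarCovU_self dbarCovIterU dbarCovIterU_zero dbarCovIterU_succ)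
open Summit.QuantumFields.YangMills.Theorems.Prop7SymFrameBound (analyticAt_coe_dbarCovU_of_twoBlock)
open Summit.QuantumFields.YangMills.Theorems.IteratedMapTelescope (orbit_sub_lin_succ hasFDerivAt_iterate_zero fderiv_iterate_zero l1_orbit_sub_lin_le_pow_of_lt)

/-! ## §1 The one-step covariant twisted average in log coordinates (generic lattice) -/

section OneStep

variable {P : Params} {𝔸 : Type*} [NormedRing 𝔸] [NormedAlgebra ℂ 𝔸] [CompleteSpace 𝔸] {j : ℕ}

/-- At `y = 0` the perturbed field is the background itself: `e^{0}·V = V`. [cite: Balaban1985Averaging, (89) p.31] -/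
theorem expUnit_zero_mul_field (V : GaugeField P j 𝔸ˣ) : (fun b : PBond P j => expUnit ((0 : PBond P j → 𝔸) b) * V b) = V := by
  funext b
  apply Units.ext
  rw [Units.val_mul, Pi.zero_apply, val_expUnit, exp_zero, one_mul]

/-- ★ **THE ONE-STEP MAP VANISHES AT `0`**: `Φ_V(0)(c) = log( U̿_V(V)(c)·V̄(c)⁻¹ ) = log 1 = 0` (✓`dbarCovU_self`). [cite: Balaban1985Averaging, (89) p.31, (127) p.36] -/
theorem phiCov_zero (V : GaugeField P j 𝔸ˣ) :
    (fun y : PBond P j → 𝔸 => fun c : PBond P (j + 1) =>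
        mlog (((dbarCovU V (fun b => expUnit (y b) * V b) c : 𝔸ˣ) : 𝔸) * (((emlAvgU V c)⁻¹ : 𝔸ˣ) : 𝔸))) 0 = 0 := by
  funext c
  show mlog (((dbarCovU V (fun b => expUnit ((0 : PBond P j → 𝔸) b) * V b) c : 𝔸ˣ) : 𝔸) * (((emlAvgU V c)⁻¹ : 𝔸ˣ) : 𝔸)) = 0
  rw [expUnit_zero_mul_field, dbarCovU_self, ← Units.val_mul, mul_inv_cancel, Units.val_one, mlog_one]

/-- The perturbed bond variable `y ↦ e^{y(b)}·V(b)` is analytic in `y` (everywhere). [cite: Balaban1985Variational, (152) p.301] -/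
theorem analyticAt_coe_expUnit_mul (V : GaugeField P j 𝔸ˣ) (b : PBond P j) (y₀ : PBond P j → 𝔸) :
    AnalyticAt ℂ (fun y : PBond P j → 𝔸 => (((expUnit (y b) * V b : 𝔸ˣ)) : 𝔸)) y₀ := by
  have h : (fun y : PBond P j → 𝔸 => (((expUnit (y b) * V b : 𝔸ˣ)) : 𝔸)) = fun y => exp (y b) * ((V b : 𝔸ˣ) : 𝔸) := by
    funext y; rw [Units.val_mul, val_expUnit]
  rw [h]
  have hproj : AnalyticAt ℂ (fun y : PBond P j → 𝔸 => y b) y₀ :=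
    (ContinuousLinearMap.proj (R := ℂ) (φ := fun _ : PBond P j => 𝔸) b).analyticAt y₀
  exact (AnalyticAt.comp_of_eq (exp_analytic _) hproj rfl).mul analyticAt_const

/-- ★ **THE ONE-STEP MAP IS DIFFERENTIABLE AT `0` AT A BACKGROUND WITH SMALL (0.4) LOOPS**: if every loop variable of `V` at `c` is within `1` of `1`, `y ↦ Φ_V(y)(c)` is analytic (hence
differentiable) at `0` — ✓`analyticAt_coe_dbarCovU_of_twoBlock` (twisted stairs of `V` against itself are `1`, ✓`tstairU_self`) times a constant, `mlog` analytic at `1`.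
[cite: Balaban1985Averaging, (89) p.31, (127) p.36; Balaban1987RG1, (0.4) p.253] -/
theorem analyticAt_phiCov_apply_zero (hj : j + 1 ≤ P.m + P.K) (V : GaugeField P j 𝔸ˣ) (c : PBond P (j + 1))
    (hloop : ∀ i : Idx P, ‖((loopHolU V c i : 𝔸ˣ) : 𝔸) - 1‖ < 1) :
    AnalyticAt ℂ (fun y : PBond P j → 𝔸 =>
        mlog (((dbarCovU V (fun b => expUnit (y b) * V b) c : 𝔸ˣ) : 𝔸) * (((emlAvgU V c)⁻¹ : 𝔸ˣ) : 𝔸))) 0 := by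
  have hV0 : (fun b : PBond P j => expUnit ((0 : PBond P j → 𝔸) b) * V b) = V := expUnit_zero_mul_field V
  have hd : AnalyticAt ℂ (fun y : PBond P j → 𝔸 => ((dbarCovU V (fun b => expUnit (y b) * V b) c : 𝔸ˣ) : 𝔸)) 0 := by
    refine analyticAt_coe_dbarCovU_of_twoBlock hj (F := fun y : PBond P j → 𝔸 => fun b => expUnit (y b) * V b) (x₀ := 0) V c
      (fun b _ _ => analyticAt_coe_expUnit_mul V b 0) ?_ ?_ ?_
    · intro i; rw [hV0]; exact hloop i
    · intro i; rw [hV0, tstairU_self, Units.val_one, sub_self, norm_zero]; exact zero_lt_one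
    · intro i; rw [hV0, tstairU_self, Units.val_one, sub_self, norm_zero]; exact zero_lt_one
  have hprod : AnalyticAt ℂ (fun y : PBond P j → 𝔸 => ((dbarCovU V (fun b => expUnit (y b) * V b) c : 𝔸ˣ) : 𝔸) * (((emlAvgU V c)⁻¹ : 𝔸ˣ) : 𝔸)) 0 :=
    hd.mul analyticAt_const
  have h1 : ((dbarCovU V (fun b => expUnit ((0 : PBond P j → 𝔸) b) * V b) c : 𝔸ˣ) : 𝔸) * (((emlAvgU V c)⁻¹ : 𝔸ˣ) : 𝔸) = 1 := by
    rw [hV0, dbarCovU_self, ← Units.val_mul, mul_inv_cancel, Units.val_one]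
  have hlog : AnalyticAt ℂ (mlog : 𝔸 → 𝔸) 1 := MatrixLog.analyticAt_mlog (by rw [sub_self, norm_zero]; exact zero_lt_one)
  have hcomp := AnalyticAt.comp_of_eq hlog hprod h1
  exact hcomp

/-- … hence `Φ_V` (all components) is differentiable at `0` when every coarse bond's loops are guarded. [cite: Balaban1985Averaging, (127) p.36; Balaban1987RG1, (0.4) p.253] -/
theorem differentiableAt_phiCov_zero (hj : j + 1 ≤ P.m + P.K) (V : GaugeField P j 𝔸ˣ)
    (hloop : ∀ (c : PBond P (j + 1)) (i : Idx P), ‖((loopHolU V c i : 𝔸ˣ) : 𝔸) - 1‖ < 1) :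
    DifferentiableAt ℂ (fun y : PBond P j → 𝔸 => fun c : PBond P (j + 1) =>
        mlog (((dbarCovU V (fun b => expUnit (y b) * V b) c : 𝔸ˣ) : 𝔸) * (((emlAvgU V c)⁻¹ : 𝔸ˣ) : 𝔸))) 0 :=
  differentiableAt_pi.2 fun c => (analyticAt_phiCov_apply_zero hj V c (hloop c)).differentiableAt

/-- ★ **ROUND TRIP — ONE LEVEL UP THE LOG TOWER IS ONE STEP OF `Φ`**: if level `m` of the covariant tower relative to the background tower is inside the log-ball,
`Y_{m+1}(X)(c) = Φ_{V_m}(Y_m(X))(c)` (`e^{log u} = u`, ✓`dbarCovIterU_succ`, ✓`emlIterU_succ`). [cite: Balaban1985Averaging, (127) p.36, (150) p.40] -/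
theorem logTower_succ (m : ℕ) (U W : GaugeField P 0 𝔸ˣ)
    (hwin : ∀ b : PBond P m, ‖((dbarCovIterU m U W b : 𝔸ˣ) : 𝔸) * (((emlIterU m U b)⁻¹ : 𝔸ˣ) : 𝔸) - 1‖ < 1) (c : PBond P (m + 1)) :
    mlog (((dbarCovIterU (m + 1) U W c : 𝔸ˣ) : 𝔸) * (((emlIterU (m + 1) U c)⁻¹ : 𝔸ˣ) : 𝔸)) =
      (fun y : PBond P m → 𝔸 => fun c' : PBond P (m + 1) =>
          mlog (((dbarCovU (emlIterU m U) (fun b => expUnit (y b) * emlIterU m U b) c' : 𝔸ˣ) : 𝔸) * (((emlAvgU (emlIterU m U) c')⁻¹ : 𝔸ˣ) : 𝔸)))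
        (fun b : PBond P m => mlog (((dbarCovIterU m U W b : 𝔸ˣ) : 𝔸) * (((emlIterU m U b)⁻¹ : 𝔸ˣ) : 𝔸))) c := by
  have hround : (fun b : PBond P m => expUnit (mlog (((dbarCovIterU m U W b : 𝔸ˣ) : 𝔸) * (((emlIterU m U b)⁻¹ : 𝔸ˣ) : 𝔸))) * emlIterU m U b) = dbarCovIterU m U W := by
    funext b
    apply Units.ext
    rw [Units.val_mul, val_expUnit, exp_mlog (hwin b), mul_assoc, ← Units.val_mul, inv_mul_cancel, Units.val_one, mul_one]
  show _ = mlog (((dbarCovU (emlIterU m U) (fun b => expUnit (mlog (((dbarCovIterU m U W b : 𝔸ˣ) : 𝔸) * (((emlIterU m U b)⁻¹ : 𝔸ˣ) : 𝔸))) * emlIterU m U b) c : 𝔸ˣ) : 𝔸) *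
      (((emlAvgU (emlIterU m U) c)⁻¹ : 𝔸ˣ) : 𝔸))
  rw [hround, ← dbarCovIterU_succ, ← emlIterU_succ]

omit [CompleteSpace 𝔸] in
/-- **THE BASE OF THE LOG TOWER IS THE EXPONENT**: `Y_0(X)(b) = log( e^{X(b)}·U₀♭(b)·U₀♭(b)⁻¹ ) = X(b)` for `‖X(b)‖ ≤ 1/5` (✓`B7Eq170Flat.mlog_exp_of_le`). [cite: Balaban1985Averaging, (21) p.21] -/
theorem logTower_zero [CompleteSpace 𝔸] (U : GaugeField P 0 𝔸ˣ) (X : PBond P 0 → 𝔸) (b : PBond P 0) (hX : ‖X b‖ ≤ 1 / 5) :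
    mlog (((dbarCovIterU 0 U (fun b' => expUnit (X b') * U b') b : 𝔸ˣ) : 𝔸) * (((emlIterU 0 U b)⁻¹ : 𝔸ˣ) : 𝔸)) = X b := by
  rw [dbarCovIterU_zero, emlIterU_zero, ← Units.val_mul, mul_assoc, mul_inv_cancel, mul_one, val_expUnit]
  exact B7Eq170Flat.mlog_exp_of_le hX

end OneStep

/-! ## §2 The formal towers (existence by recursion, no definition) and the round trip up to a level -/

section Tower

variable {P : Params} {𝔸 : Type*} [NormedRing 𝔸] [NormedAlgebra ℂ 𝔸] [CompleteSpace 𝔸]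

/-- **THE FORMAL COMPOSED TOWER EXISTS** (`F_0 = id`, `F_{m+1} = Φ_{V_m} ∘ F_m`, `V_m = Ū^{(m)}`) — by recursion on the level; stated as an existence so that no definition enters the tree.
[cite: Balaban1985Averaging, (127) p.36] -/
theorem exists_iterate (U : GaugeField P 0 𝔸ˣ) :
    ∃ Fm : (m : ℕ) → (PBond P 0 → 𝔸) → (PBond P m → 𝔸), (∀ x, Fm 0 x = x) ∧
      ∀ (m : ℕ) (x : PBond P 0 → 𝔸), Fm (m + 1) x =
        (fun y : PBond P m → 𝔸 => fun c : PBond P (m + 1) =>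
          mlog (((dbarCovU (emlIterU m U) (fun b => expUnit (y b) * emlIterU m U b) c : 𝔸ˣ) : 𝔸) * (((emlAvgU (emlIterU m U) c)⁻¹ : 𝔸ˣ) : 𝔸))) (Fm m x) :=
  ⟨fun m => Nat.rec (motive := fun m => (PBond P 0 → 𝔸) → (PBond P m → 𝔸)) (fun x => x)
      (fun m g x => fun c : PBond P (m + 1) =>
        mlog (((dbarCovU (emlIterU m U) (fun b => expUnit (g x b) * emlIterU m U b) c : 𝔸ˣ) : 𝔸) * (((emlAvgU (emlIterU m U) c)⁻¹ : 𝔸ˣ) : 𝔸))) m,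
    fun _ => rfl, fun _ _ => rfl⟩

/-- **THE FORMAL COMPOSED LINEAR PARTS EXIST** (`Lin_0 = id`, `Lin_{m+1} = DΦ_{V_m}(0) ∘ Lin_m`). [cite: Balaban1985Averaging, (127) p.36, (141) p.39] -/
theorem exists_lin (U : GaugeField P 0 𝔸ˣ) :
    ∃ Lin : (m : ℕ) → (PBond P 0 → 𝔸) →L[ℂ] (PBond P m → 𝔸), Lin 0 = ContinuousLinearMap.id ℂ (PBond P 0 → 𝔸) ∧
      ∀ m : ℕ, Lin (m + 1) =
        (fderiv ℂ (fun y : PBond P m → 𝔸 => fun c : PBond P (m + 1) =>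
          mlog (((dbarCovU (emlIterU m U) (fun b => expUnit (y b) * emlIterU m U b) c : 𝔸ˣ) : 𝔸) * (((emlAvgU (emlIterU m U) c)⁻¹ : 𝔸ˣ) : 𝔸))) 0).comp (Lin m) :=
  ⟨fun m => Nat.rec (motive := fun m => (PBond P 0 → 𝔸) →L[ℂ] (PBond P m → 𝔸)) (ContinuousLinearMap.id ℂ (PBond P 0 → 𝔸))
      (fun m Lm => (fderiv ℂ (fun y : PBond P m → 𝔸 => fun c : PBond P (m + 1) =>
          mlog (((dbarCovU (emlIterU m U) (fun b => expUnit (y b) * emlIterU m U b) c : 𝔸ˣ) : 𝔸) * (((emlAvgU (emlIterU m U) c)⁻¹ : 𝔸ˣ) : 𝔸))) 0).comp Lm) m,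
    rfl, fun _ => rfl⟩

/-- ★★ **THE LOG TOWER IS THE FORMAL COMPOSED TOWER UP TO LEVEL `k`** under the base window `‖X b‖ ≤ 1/5` and the per-level windows `‖U̿^{(m)}(e^{X}U)(b)·Ū^{(m)}(b)⁻¹ − 1‖ < 1`, `m < k`
(round trip `exp ∘ log` inside the ball, §1). [cite: Balaban1985Averaging, (127) p.36, (150) p.40] -/
theorem logTower_eq_iterate (U : GaugeField P 0 𝔸ˣ) (Fm : (m : ℕ) → (PBond P 0 → 𝔸) → (PBond P m → 𝔸)) (hF0 : ∀ x, Fm 0 x = x)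
    (hFs : ∀ (m : ℕ) (x : PBond P 0 → 𝔸), Fm (m + 1) x =
        (fun y : PBond P m → 𝔸 => fun c : PBond P (m + 1) =>
          mlog (((dbarCovU (emlIterU m U) (fun b => expUnit (y b) * emlIterU m U b) c : 𝔸ˣ) : 𝔸) * (((emlAvgU (emlIterU m U) c)⁻¹ : 𝔸ˣ) : 𝔸))) (Fm m x))
    (X : PBond P 0 → 𝔸) (hX : ∀ b, ‖X b‖ ≤ 1 / 5) (k : ℕ)
    (hwin : ∀ m, m < k → ∀ b : PBond P m,
      ‖((dbarCovIterU m U (fun b' => expUnit (X b') * U b') b : 𝔸ˣ) : 𝔸) * (((emlIterU m U b)⁻¹ : 𝔸ˣ) : 𝔸) - 1‖ < 1) :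
    ∀ m, m ≤ k → ∀ c : PBond P m,
      mlog (((dbarCovIterU m U (fun b' => expUnit (X b') * U b') c : 𝔸ˣ) : 𝔸) * (((emlIterU m U c)⁻¹ : 𝔸ˣ) : 𝔸)) = Fm m X c := by
  intro m
  induction m with
  | zero => intro _ c; rw [hF0, logTower_zero U X c (hX c)]
  | succ m ih =>
    intro hm c
    have hm' : m < k := Nat.lt_of_succ_le hm
    have hprev : (fun b : PBond P m => mlog (((dbarCovIterU m U (fun b' => expUnit (X b') * U b') b : 𝔸ˣ) : 𝔸) * (((emlIterU m U b)⁻¹ : 𝔸ˣ) : 𝔸))) = Fm m X :=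
      funext fun b => ih hm'.le b
    rw [logTower_succ m U _ (hwin m hm') c, hFs m X, ← hprev]

end Tower

/-! ## §3 At the T³ letters: the chart IS the top of the tower; the remainder is the Duhamel sum -/

section T3

open Literature.MathematicalPhysics.QuantumFieldTheory.Balaban1983to89.T3ContinuumYM3Torus
open T3SectALandauChart (bgUnits)
open T3LevelShift (bondShift)
open T3PrintedRegularOrbits (sites_eq)
open Summit.QuantumFields.YangMills.Theorems.Prop7SymAvgTwSym (dbarTwS logChartTwS logChartTwS_apply QTwS QTwS_def CmapTwS CmapTwS_apply dbarTwS_eq_dbarCovIterU_mul_inv)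

variable (F : T3Family) (n K : ℕ) (h : n ≤ K) (U₀ : GaugeField (F.P K) 0 (Matrix.specialUnitaryGroup (Fin 2) ℂ))

/-- ★★ **THE TWISTED LOG-CHART IS THE TOP OF THE COVARIANT LOG TOWER** (unconditionally, as objects): `log U̿^{twS}(X)(c) = log( U̿^{(K−n)}(e^{X}U₀♭)(ĉ)·Ū₀♭^{(K−n)}(ĉ)⁻¹ )`,
`ĉ = bondShift (sites_eq F n K h) c` (✓`dbarTwS_eq_dbarCovIterU_mul_inv`). [cite: Balaban1985Averaging, (92) p.31, (97) p.32, (127) p.36] -/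
theorem logChartTwS_apply_eq_logTower_top (X : PBond (F.P K) 0 → Matrix (Fin 2) (Fin 2) ℂ) (c : PBond (F.P n) 0) :
    logChartTwS F n K h U₀ X c =
      mlog (((dbarCovIterU (K - n) (bgUnits F K U₀) (fun b' => expUnit (X b') * bgUnits F K U₀ b') (bondShift (sites_eq F n K h) c) : (Matrix (Fin 2) (Fin 2) ℂ)ˣ) : Matrix (Fin 2) (Fin 2) ℂ) *
        (((emlIterU (K - n) (bgUnits F K U₀) (bondShift (sites_eq F n K h) c))⁻¹ : (Matrix (Fin 2) (Fin 2) ℂ)ˣ) : Matrix (Fin 2) (Fin 2) ℂ)) := by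
  rw [logChartTwS_apply, dbarTwS_eq_dbarCovIterU_mul_inv, Units.val_mul]

/-- ★★ **… AND EQUALS THE FORMAL COMPOSED TOWER AT THE TOP on the windows** (§2). [cite: Balaban1985Averaging, (127) p.36, (150) p.40] -/
theorem logChartTwS_apply_eq_iterate_top
    (Fm : (m : ℕ) → (PBond (F.P K) 0 → Matrix (Fin 2) (Fin 2) ℂ) → (PBond (F.P K) m → Matrix (Fin 2) (Fin 2) ℂ)) (hF0 : ∀ x, Fm 0 x = x)
    (hFs : ∀ (m : ℕ) (x : PBond (F.P K) 0 → Matrix (Fin 2) (Fin 2) ℂ), Fm (m + 1) x =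
        (fun y : PBond (F.P K) m → Matrix (Fin 2) (Fin 2) ℂ => fun c : PBond (F.P K) (m + 1) =>
          mlog (((dbarCovU (emlIterU m (bgUnits F K U₀)) (fun b => expUnit (y b) * emlIterU m (bgUnits F K U₀) b) c : (Matrix (Fin 2) (Fin 2) ℂ)ˣ) : Matrix (Fin 2) (Fin 2) ℂ) *
            (((emlAvgU (emlIterU m (bgUnits F K U₀)) c)⁻¹ : (Matrix (Fin 2) (Fin 2) ℂ)ˣ) : Matrix (Fin 2) (Fin 2) ℂ))) (Fm m x))
    (X : PBond (F.P K) 0 → Matrix (Fin 2) (Fin 2) ℂ) (hX : ∀ b, ‖X b‖ ≤ 1 / 5)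
    (hwin : ∀ m, m < K - n → ∀ b : PBond (F.P K) m,
      ‖((dbarCovIterU m (bgUnits F K U₀) (fun b' => expUnit (X b') * bgUnits F K U₀ b') b : (Matrix (Fin 2) (Fin 2) ℂ)ˣ) : Matrix (Fin 2) (Fin 2) ℂ) *
          (((emlIterU m (bgUnits F K U₀) b)⁻¹ : (Matrix (Fin 2) (Fin 2) ℂ)ˣ) : Matrix (Fin 2) (Fin 2) ℂ) - 1‖ < 1)
    (c : PBond (F.P n) 0) :
    logChartTwS F n K h U₀ X c = Fm (K - n) X (bondShift (sites_eq F n K h) c) := by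
  rw [logChartTwS_apply_eq_logTower_top]
  exact logTower_eq_iterate (bgUnits F K U₀) Fm hF0 hFs X hX (K - n) hwin (K - n) le_rfl _

/-- ★★ **THE LINEAR PART `Q(U₀) = QTwS` IS THE COMPOSED ONE-STEP LINEAR PART** read at `ĉ`: if the windows hold on a whole ball `‖X‖ < r` (so the chart and the top of the formal tower AGREE NEAR `0`)
and every one-step map is differentiable at `0`, then `QTwS F n K h U₀ X c = Lin_{K−n} X ĉ` for every `X` (✓`IteratedMapTelescope.hasFDerivAt_iterate_zero`, uniqueness of the derivative).
[cite: Balaban1985Averaging, (127) p.36, (141) p.39; Balaban1985BackgroundPropagators, (3.14) p.393] -/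
theorem QTwS_apply_eq_lin_top
    (Fm : (m : ℕ) → (PBond (F.P K) 0 → Matrix (Fin 2) (Fin 2) ℂ) → (PBond (F.P K) m → Matrix (Fin 2) (Fin 2) ℂ)) (hF0 : ∀ x, Fm 0 x = x)
    (hFs : ∀ (m : ℕ) (x : PBond (F.P K) 0 → Matrix (Fin 2) (Fin 2) ℂ), Fm (m + 1) x =
        (fun y : PBond (F.P K) m → Matrix (Fin 2) (Fin 2) ℂ => fun c : PBond (F.P K) (m + 1) =>
          mlog (((dbarCovU (emlIterU m (bgUnits F K U₀)) (fun b => expUnit (y b) * emlIterU m (bgUnits F K U₀) b) c : (Matrix (Fin 2) (Fin 2) ℂ)ˣ) : Matrix (Fin 2) (Fin 2) ℂ) *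
            (((emlAvgU (emlIterU m (bgUnits F K U₀)) c)⁻¹ : (Matrix (Fin 2) (Fin 2) ℂ)ˣ) : Matrix (Fin 2) (Fin 2) ℂ))) (Fm m x))
    (Lin : (m : ℕ) → (PBond (F.P K) 0 → Matrix (Fin 2) (Fin 2) ℂ) →L[ℂ] (PBond (F.P K) m → Matrix (Fin 2) (Fin 2) ℂ))
    (hLin0 : Lin 0 = ContinuousLinearMap.id ℂ (PBond (F.P K) 0 → Matrix (Fin 2) (Fin 2) ℂ))
    (hLins : ∀ m : ℕ, Lin (m + 1) =
        (fderiv ℂ (fun y : PBond (F.P K) m → Matrix (Fin 2) (Fin 2) ℂ => fun c : PBond (F.P K) (m + 1) =>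
          mlog (((dbarCovU (emlIterU m (bgUnits F K U₀)) (fun b => expUnit (y b) * emlIterU m (bgUnits F K U₀) b) c : (Matrix (Fin 2) (Fin 2) ℂ)ˣ) : Matrix (Fin 2) (Fin 2) ℂ) *
            (((emlAvgU (emlIterU m (bgUnits F K U₀)) c)⁻¹ : (Matrix (Fin 2) (Fin 2) ℂ)ˣ) : Matrix (Fin 2) (Fin 2) ℂ))) 0).comp (Lin m))
    {r : ℝ} (hr : 0 < r)
    (hwinr : ∀ X : PBond (F.P K) 0 → Matrix (Fin 2) (Fin 2) ℂ, ‖X‖ < r → (∀ b, ‖X b‖ ≤ 1 / 5) ∧ ∀ m, m < K - n → ∀ b : PBond (F.P K) m,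
      ‖((dbarCovIterU m (bgUnits F K U₀) (fun b' => expUnit (X b') * bgUnits F K U₀ b') b : (Matrix (Fin 2) (Fin 2) ℂ)ˣ) : Matrix (Fin 2) (Fin 2) ℂ) *
          (((emlIterU m (bgUnits F K U₀) b)⁻¹ : (Matrix (Fin 2) (Fin 2) ℂ)ˣ) : Matrix (Fin 2) (Fin 2) ℂ) - 1‖ < 1)
    (hdiff : ∀ m, m < K - n → DifferentiableAt ℂ (fun y : PBond (F.P K) m → Matrix (Fin 2) (Fin 2) ℂ => fun c : PBond (F.P K) (m + 1) =>
          mlog (((dbarCovU (emlIterU m (bgUnits F K U₀)) (fun b => expUnit (y b) * emlIterU m (bgUnits F K U₀) b) c : (Matrix (Fin 2) (Fin 2) ℂ)ˣ) : Matrix (Fin 2) (Fin 2) ℂ) *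
            (((emlAvgU (emlIterU m (bgUnits F K U₀)) c)⁻¹ : (Matrix (Fin 2) (Fin 2) ℂ)ˣ) : Matrix (Fin 2) (Fin 2) ℂ))) 0)
    (X : PBond (F.P K) 0 → Matrix (Fin 2) (Fin 2) ℂ) (c : PBond (F.P n) 0) :
    QTwS F n K h U₀ X c = Lin (K - n) X (bondShift (sites_eq F n K h) c) := by
  -- the one-step maps vanish at `0`, so the composed map has derivative `Lin_{K−n}` at `0`
  have hf0 : ∀ m : ℕ, (fun y : PBond (F.P K) m → Matrix (Fin 2) (Fin 2) ℂ => fun c : PBond (F.P K) (m + 1) =>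
          mlog (((dbarCovU (emlIterU m (bgUnits F K U₀)) (fun b => expUnit (y b) * emlIterU m (bgUnits F K U₀) b) c : (Matrix (Fin 2) (Fin 2) ℂ)ˣ) : Matrix (Fin 2) (Fin 2) ℂ) *
            (((emlAvgU (emlIterU m (bgUnits F K U₀)) c)⁻¹ : (Matrix (Fin 2) (Fin 2) ℂ)ˣ) : Matrix (Fin 2) (Fin 2) ℂ))) 0 = 0 :=
    fun m => phiCov_zero (emlIterU m (bgUnits F K U₀))
  have hFD : HasFDerivAt (Fm (K - n)) (Lin (K - n)) 0 :=
    hasFDerivAt_iterate_zero (fun m => PBond (F.P K) m) _ _ Lin hLin0 hLins Fm hF0 hFs hf0 (K - n) fun m hm => (hdiff m hm).hasFDerivAt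
  -- the chart agrees with the top of the formal tower near `0`, read along `bondShift`
  obtain ⟨ρ, hρ⟩ : ∃ ρ : (PBond (F.P K) (K - n) → Matrix (Fin 2) (Fin 2) ℂ) →L[ℂ] (PBond (F.P n) 0 → Matrix (Fin 2) (Fin 2) ℂ),
      ∀ v c', ρ v c' = v (bondShift (sites_eq F n K h) c') :=
    ⟨ContinuousLinearMap.pi fun c' : PBond (F.P n) 0 =>
        ContinuousLinearMap.proj (R := ℂ) (φ := fun _ : PBond (F.P K) (K - n) => Matrix (Fin 2) (Fin 2) ℂ) (bondShift (sites_eq F n K h) c'), fun _ _ => rfl⟩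
  have hev : (logChartTwS F n K h U₀) =ᶠ[nhds 0] fun X' => ρ (Fm (K - n) X') := by
    filter_upwards [Metric.ball_mem_nhds (0 : PBond (F.P K) 0 → Matrix (Fin 2) (Fin 2) ℂ) hr] with X' hX'
    funext c'
    rw [hρ]
    exact logChartTwS_apply_eq_iterate_top F n K h U₀ Fm hF0 hFs X' (hwinr X' (mem_ball_zero_iff.1 hX')).1 (hwinr X' (mem_ball_zero_iff.1 hX')).2 c'
  have hcomp : HasFDerivAt (fun X' => ρ (Fm (K - n) X')) (ρ.comp (Lin (K - n))) 0 := ρ.hasFDerivAt.comp 0 hFD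
  have hchart : HasFDerivAt (logChartTwS F n K h U₀) (ρ.comp (Lin (K - n))) 0 := hcomp.congr_of_eventuallyEq hev
  rw [QTwS_def, hchart.fderiv, ContinuousLinearMap.comp_apply, hρ]

/-- ★★★ **F0″ — THE CHART REMAINDER IS «TOWER MINUS ITS LINEAR PROPAGATION» AT THE TOP**: on the ball of the windows, `C^{twS}(X)(c) = (F_{K−n} X − Lin_{K−n} X)(ĉ)`; consequently the EXACT
one-step recursion ✓`IteratedMapTelescope.orbit_sub_lin_succ` — print's (152) — applies verbatim to `C^{twS}` along the levels. [cite: Balaban1985Averaging, (150)–(152) p.40; Balaban1985Variational, (44) p.285] -/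
theorem CmapTwS_apply_eq_iterate_sub_lin
    (Fm : (m : ℕ) → (PBond (F.P K) 0 → Matrix (Fin 2) (Fin 2) ℂ) → (PBond (F.P K) m → Matrix (Fin 2) (Fin 2) ℂ)) (hF0 : ∀ x, Fm 0 x = x)
    (hFs : ∀ (m : ℕ) (x : PBond (F.P K) 0 → Matrix (Fin 2) (Fin 2) ℂ), Fm (m + 1) x =
        (fun y : PBond (F.P K) m → Matrix (Fin 2) (Fin 2) ℂ => fun c : PBond (F.P K) (m + 1) =>
          mlog (((dbarCovU (emlIterU m (bgUnits F K U₀)) (fun b => expUnit (y b) * emlIterU m (bgUnits F K U₀) b) c : (Matrix (Fin 2) (Fin 2) ℂ)ˣ) : Matrix (Fin 2) (Fin 2) ℂ) *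
            (((emlAvgU (emlIterU m (bgUnits F K U₀)) c)⁻¹ : (Matrix (Fin 2) (Fin 2) ℂ)ˣ) : Matrix (Fin 2) (Fin 2) ℂ))) (Fm m x))
    (Lin : (m : ℕ) → (PBond (F.P K) 0 → Matrix (Fin 2) (Fin 2) ℂ) →L[ℂ] (PBond (F.P K) m → Matrix (Fin 2) (Fin 2) ℂ))
    (hLin0 : Lin 0 = ContinuousLinearMap.id ℂ (PBond (F.P K) 0 → Matrix (Fin 2) (Fin 2) ℂ))
    (hLins : ∀ m : ℕ, Lin (m + 1) =
        (fderiv ℂ (fun y : PBond (F.P K) m → Matrix (Fin 2) (Fin 2) ℂ => fun c : PBond (F.P K) (m + 1) =>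
          mlog (((dbarCovU (emlIterU m (bgUnits F K U₀)) (fun b => expUnit (y b) * emlIterU m (bgUnits F K U₀) b) c : (Matrix (Fin 2) (Fin 2) ℂ)ˣ) : Matrix (Fin 2) (Fin 2) ℂ) *
            (((emlAvgU (emlIterU m (bgUnits F K U₀)) c)⁻¹ : (Matrix (Fin 2) (Fin 2) ℂ)ˣ) : Matrix (Fin 2) (Fin 2) ℂ))) 0).comp (Lin m))
    {r : ℝ} (hr : 0 < r)
    (hwinr : ∀ X : PBond (F.P K) 0 → Matrix (Fin 2) (Fin 2) ℂ, ‖X‖ < r → (∀ b, ‖X b‖ ≤ 1 / 5) ∧ ∀ m, m < K - n → ∀ b : PBond (F.P K) m,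
      ‖((dbarCovIterU m (bgUnits F K U₀) (fun b' => expUnit (X b') * bgUnits F K U₀ b') b : (Matrix (Fin 2) (Fin 2) ℂ)ˣ) : Matrix (Fin 2) (Fin 2) ℂ) *
          (((emlIterU m (bgUnits F K U₀) b)⁻¹ : (Matrix (Fin 2) (Fin 2) ℂ)ˣ) : Matrix (Fin 2) (Fin 2) ℂ) - 1‖ < 1)
    (hdiff : ∀ m, m < K - n → DifferentiableAt ℂ (fun y : PBond (F.P K) m → Matrix (Fin 2) (Fin 2) ℂ => fun c : PBond (F.P K) (m + 1) =>
          mlog (((dbarCovU (emlIterU m (bgUnits F K U₀)) (fun b => expUnit (y b) * emlIterU m (bgUnits F K U₀) b) c : (Matrix (Fin 2) (Fin 2) ℂ)ˣ) : Matrix (Fin 2) (Fin 2) ℂ) *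
            (((emlAvgU (emlIterU m (bgUnits F K U₀)) c)⁻¹ : (Matrix (Fin 2) (Fin 2) ℂ)ˣ) : Matrix (Fin 2) (Fin 2) ℂ))) 0)
    (X : PBond (F.P K) 0 → Matrix (Fin 2) (Fin 2) ℂ) (hXr : ‖X‖ < r) (c : PBond (F.P n) 0) :
    CmapTwS F n K h U₀ X c = (Fm (K - n) X - Lin (K - n) X) (bondShift (sites_eq F n K h) c) := by
  rw [CmapTwS_apply, Pi.sub_apply, Pi.sub_apply,
    logChartTwS_apply_eq_iterate_top F n K h U₀ Fm hF0 hFs X (hwinr X hXr).1 (hwinr X hXr).2 c,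
    QTwS_apply_eq_lin_top F n K h U₀ Fm hF0 hFs Lin hLin0 hLins hr hwinr hdiff X c]

/-- ★★★ **F0″ — THE ℓ¹ SIZE OF THE CHART REMAINDER IS THE DAMPED SUM OF THE ONE-STEP DEFECTS** (what F2″∕F4″ of P-A2 consume): with F2″'s column-sum letter `Σ_c‖T_m v c‖ ≤ κ·Σ_c‖v c‖` for the
one-step linear parts `T_m = DΦ_{V_m}(0)`, on the ball of the windows,
`Σ_{c : PBond (F.P n) 0} ‖C^{twS}(X)(c)‖ ≤ Σ_{l < K−n} κ^{K−n−1−l} · Σ_{c′} ‖(Φ_{V_l}(F_l X) − T_l (F_l X)) c′‖`. [cite: Balaban1985Averaging, (150)–(152) p.40; Balaban1985Variational, (44) p.285] -/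
theorem l1_CmapTwS_le_damped_defects
    (Fm : (m : ℕ) → (PBond (F.P K) 0 → Matrix (Fin 2) (Fin 2) ℂ) → (PBond (F.P K) m → Matrix (Fin 2) (Fin 2) ℂ)) (hF0 : ∀ x, Fm 0 x = x)
    (hFs : ∀ (m : ℕ) (x : PBond (F.P K) 0 → Matrix (Fin 2) (Fin 2) ℂ), Fm (m + 1) x =
        (fun y : PBond (F.P K) m → Matrix (Fin 2) (Fin 2) ℂ => fun c : PBond (F.P K) (m + 1) =>
          mlog (((dbarCovU (emlIterU m (bgUnits F K U₀)) (fun b => expUnit (y b) * emlIterU m (bgUnits F K U₀) b) c : (Matrix (Fin 2) (Fin 2) ℂ)ˣ) : Matrix (Fin 2) (Fin 2) ℂ) *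
            (((emlAvgU (emlIterU m (bgUnits F K U₀)) c)⁻¹ : (Matrix (Fin 2) (Fin 2) ℂ)ˣ) : Matrix (Fin 2) (Fin 2) ℂ))) (Fm m x))
    (Lin : (m : ℕ) → (PBond (F.P K) 0 → Matrix (Fin 2) (Fin 2) ℂ) →L[ℂ] (PBond (F.P K) m → Matrix (Fin 2) (Fin 2) ℂ))
    (hLin0 : Lin 0 = ContinuousLinearMap.id ℂ (PBond (F.P K) 0 → Matrix (Fin 2) (Fin 2) ℂ))
    (hLins : ∀ m : ℕ, Lin (m + 1) =
        (fderiv ℂ (fun y : PBond (F.P K) m → Matrix (Fin 2) (Fin 2) ℂ => fun c : PBond (F.P K) (m + 1) =>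
          mlog (((dbarCovU (emlIterU m (bgUnits F K U₀)) (fun b => expUnit (y b) * emlIterU m (bgUnits F K U₀) b) c : (Matrix (Fin 2) (Fin 2) ℂ)ˣ) : Matrix (Fin 2) (Fin 2) ℂ) *
            (((emlAvgU (emlIterU m (bgUnits F K U₀)) c)⁻¹ : (Matrix (Fin 2) (Fin 2) ℂ)ˣ) : Matrix (Fin 2) (Fin 2) ℂ))) 0).comp (Lin m))
    {r : ℝ} (hr : 0 < r)
    (hwinr : ∀ X : PBond (F.P K) 0 → Matrix (Fin 2) (Fin 2) ℂ, ‖X‖ < r → (∀ b, ‖X b‖ ≤ 1 / 5) ∧ ∀ m, m < K - n → ∀ b : PBond (F.P K) m,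
      ‖((dbarCovIterU m (bgUnits F K U₀) (fun b' => expUnit (X b') * bgUnits F K U₀ b') b : (Matrix (Fin 2) (Fin 2) ℂ)ˣ) : Matrix (Fin 2) (Fin 2) ℂ) *
          (((emlIterU m (bgUnits F K U₀) b)⁻¹ : (Matrix (Fin 2) (Fin 2) ℂ)ˣ) : Matrix (Fin 2) (Fin 2) ℂ) - 1‖ < 1)
    (hdiff : ∀ m, m < K - n → DifferentiableAt ℂ (fun y : PBond (F.P K) m → Matrix (Fin 2) (Fin 2) ℂ => fun c : PBond (F.P K) (m + 1) =>
          mlog (((dbarCovU (emlIterU m (bgUnits F K U₀)) (fun b => expUnit (y b) * emlIterU m (bgUnits F K U₀) b) c : (Matrix (Fin 2) (Fin 2) ℂ)ˣ) : Matrix (Fin 2) (Fin 2) ℂ) *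
            (((emlAvgU (emlIterU m (bgUnits F K U₀)) c)⁻¹ : (Matrix (Fin 2) (Fin 2) ℂ)ˣ) : Matrix (Fin 2) (Fin 2) ℂ))) 0)
    {κ : ℝ} (hκ : 0 ≤ κ)
    (hT : ∀ m : ℕ, m < K - n → ∀ v : PBond (F.P K) m → Matrix (Fin 2) (Fin 2) ℂ, ∑ c, ‖fderiv ℂ (fun y : PBond (F.P K) m → Matrix (Fin 2) (Fin 2) ℂ => fun c : PBond (F.P K) (m + 1) =>
          mlog (((dbarCovU (emlIterU m (bgUnits F K U₀)) (fun b => expUnit (y b) * emlIterU m (bgUnits F K U₀) b) c : (Matrix (Fin 2) (Fin 2) ℂ)ˣ) : Matrix (Fin 2) (Fin 2) ℂ) *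
            (((emlAvgU (emlIterU m (bgUnits F K U₀)) c)⁻¹ : (Matrix (Fin 2) (Fin 2) ℂ)ˣ) : Matrix (Fin 2) (Fin 2) ℂ))) 0 v c‖ ≤ κ * ∑ c', ‖v c'‖)
    (X : PBond (F.P K) 0 → Matrix (Fin 2) (Fin 2) ℂ) (hXr : ‖X‖ < r) :
    ∑ c : PBond (F.P n) 0, ‖CmapTwS F n K h U₀ X c‖ ≤
      ∑ l ∈ Finset.range (K - n), κ ^ (K - n - 1 - l) * ∑ c', ‖((fun y : PBond (F.P K) l → Matrix (Fin 2) (Fin 2) ℂ => fun c : PBond (F.P K) (l + 1) =>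
          mlog (((dbarCovU (emlIterU l (bgUnits F K U₀)) (fun b => expUnit (y b) * emlIterU l (bgUnits F K U₀) b) c : (Matrix (Fin 2) (Fin 2) ℂ)ˣ) : Matrix (Fin 2) (Fin 2) ℂ) *
            (((emlAvgU (emlIterU l (bgUnits F K U₀)) c)⁻¹ : (Matrix (Fin 2) (Fin 2) ℂ)ˣ) : Matrix (Fin 2) (Fin 2) ℂ))) (Fm l X) -
        fderiv ℂ (fun y : PBond (F.P K) l → Matrix (Fin 2) (Fin 2) ℂ => fun c : PBond (F.P K) (l + 1) =>
          mlog (((dbarCovU (emlIterU l (bgUnits F K U₀)) (fun b => expUnit (y b) * emlIterU l (bgUnits F K U₀) b) c : (Matrix (Fin 2) (Fin 2) ℂ)ˣ) : Matrix (Fin 2) (Fin 2) ℂ) *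
            (((emlAvgU (emlIterU l (bgUnits F K U₀)) c)⁻¹ : (Matrix (Fin 2) (Fin 2) ℂ)ˣ) : Matrix (Fin 2) (Fin 2) ℂ))) 0 (Fm l X)) c'‖ := by
  -- re-index the left side along `bondShift : PBond (F.P n) 0 ≃ PBond (F.P K) (K − n)` and rewrite each summand by §3's exact identity
  have hsum : ∑ c : PBond (F.P n) 0, ‖CmapTwS F n K h U₀ X c‖ = ∑ c' : PBond (F.P K) (K - n), ‖(Fm (K - n) X - Lin (K - n) X) c'‖ :=
    Fintype.sum_equiv (bondShift (sites_eq F n K h)) _ _ fun c => by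
      rw [CmapTwS_apply_eq_iterate_sub_lin F n K h U₀ Fm hF0 hFs Lin hLin0 hLins hr hwinr hdiff X hXr c]
  rw [hsum]
  have h := l1_orbit_sub_lin_le_pow_of_lt (fun m => PBond (F.P K) m)
    (fun m => fun y : PBond (F.P K) m → Matrix (Fin 2) (Fin 2) ℂ => fun c : PBond (F.P K) (m + 1) =>
          mlog (((dbarCovU (emlIterU m (bgUnits F K U₀)) (fun b => expUnit (y b) * emlIterU m (bgUnits F K U₀) b) c : (Matrix (Fin 2) (Fin 2) ℂ)ˣ) : Matrix (Fin 2) (Fin 2) ℂ) *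
            (((emlAvgU (emlIterU m (bgUnits F K U₀)) c)⁻¹ : (Matrix (Fin 2) (Fin 2) ℂ)ˣ) : Matrix (Fin 2) (Fin 2) ℂ)))
    (fun m => fderiv ℂ (fun y : PBond (F.P K) m → Matrix (Fin 2) (Fin 2) ℂ => fun c : PBond (F.P K) (m + 1) =>
          mlog (((dbarCovU (emlIterU m (bgUnits F K U₀)) (fun b => expUnit (y b) * emlIterU m (bgUnits F K U₀) b) c : (Matrix (Fin 2) (Fin 2) ℂ)ˣ) : Matrix (Fin 2) (Fin 2) ℂ) *
            (((emlAvgU (emlIterU m (bgUnits F K U₀)) c)⁻¹ : (Matrix (Fin 2) (Fin 2) ℂ)ˣ) : Matrix (Fin 2) (Fin 2) ℂ))) 0)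
    Lin hLin0 hLins (fun m => Fm m X) (fun m => hFs m X) (K - n) hκ hT
  rwa [hF0] at h

end T3

end Summit.QuantumFields.YangMills.Theorems.Prop7CovLogTower

end
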